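import Summits.Parity.GeneralizedHardyLittlewood.Theorems.LeeYangFibresRelativeDimOneTypeDataD
import HarnessLib

/-!
# Route `LeeYangFibres`, crux `RelativeDimOne` (stmt-Parity-14113), line `gallagher-backwards-split` (RESHAPED,
# type-conditioned split): type-cell averages for `stub_typeRigidity` — frozen smooth moduli and the CRT factorisation

Helper file for the registered stub `stub_typeRigidity : TypeRigidity` (lead seat c1). Two facts about the conditional
average `condAvg q w a b₀ g = (Σ_{v ∈ typeCell q w a b₀} g v) / #typeCell q w a b₀` of the vocabulary
`LeeYangFibresRelativeDimOneTypeDefs`: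

* FROZEN SMOOTH MODULI (`condAvg_eq_of_smooth`): if every prime factor of the squarefree modulus `q` is `≤ w`, a
  type-invariant spectrum is constant on the cell, so `condAvg q w a b₀ (e q) = e q b₀`;
* CRT FACTORISATION (`condAvg_factor`, registered hook `rigidity_condAvg_factor`): with `P = ∏_{p ≤ w} p`,
  `q₁ = gcd(q, P)`, `q₂ = q / q₁` (the convention of `TypeDataProof.rough_part_facts` / `cell_residue_sum`), for `F`
  determined by the incidence types at the primes of `q₁` and `G` `q₂`-periodic,
  `condAvg q w a b₀ (F · G) = F(b₀) · (Σ_{y ∈ [0,q₂)^t} G y) / q₂^t` — the cell is `typeCell q₁ × (ℤ/q₂)^t`.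

Both are the `t`-tuple versions of the pair-slice computations of `pairRigidityWeighted` (p112112); the CRT is
`TypeDataProof.sum_piFinset_mul_of_coprime` (p118285).
-/

noncomputable section

open scoped BigOperators Classical
open Finset Literature.NumberTheory.Sieve
open Summit.Parity.GeneralizedHardyLittlewood.Cruxes.RelativeDimOne.GallagherBackwardsSplit

namespace Summit.Parity.GeneralizedHardyLittlewood.Cruxes.RelativeDimOne.TypeSplit

namespace RigidityProof

open TypeDataProof

variable {t : ℕ}

/-! ### Generalities on `condAvg` -/

/-- `condAvg` is monotone in the integrand. -/
theorem condAvg_mono (q w : ℕ) (a b₀ : Fin t → ℤ) {g g' : (Fin t → ℤ) → ℝ} (h : ∀ b, g b ≤ g' b) :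
    condAvg q w a b₀ g ≤ condAvg q w a b₀ g' := by
  unfold condAvg
  exact div_le_div_of_nonneg_right (Finset.sum_le_sum fun v _ => h _) (Nat.cast_nonneg _)

/-- `condAvg` is homogeneous. -/
theorem condAvg_const_mul (q w : ℕ) (a b₀ : Fin t → ℤ) (c : ℝ) (g : (Fin t → ℤ) → ℝ) :
    condAvg q w a b₀ (fun b => c * g b) = c * condAvg q w a b₀ g := by
  unfold condAvg
  rw [← Finset.mul_sum, mul_div_assoc]

/-- The average of a function that is constant on a non-empty cell is that constant. -/
theorem condAvg_eq_of_forall {q w : ℕ} {a b₀ : Fin t → ℤ} {g : (Fin t → ℤ) → ℝ} {c : ℝ}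
    (hne : 0 < (typeCell q w a b₀).card) (h : ∀ v ∈ typeCell q w a b₀, g (fun i => (v i : ℤ)) = c) :
    condAvg q w a b₀ g = c := by
  unfold condAvg
  rw [Finset.sum_congr rfl h, Finset.sum_const, nsmul_eq_mul]
  have : ((typeCell q w a b₀).card : ℝ) ≠ 0 := by exact_mod_cast hne.ne'
  field_simp

/-- The residue vector of the target lies in `typeCell q w a b₀` (every `w`). -/
theorem natVec_mem_typeCell' {q : ℕ} (hq : 0 < q) (w : ℕ) (a b₀ : Fin t → ℤ) :
    (fun i => (b₀ i % (q : ℤ)).toNat) ∈ typeCell q w a b₀ := by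
  unfold typeCell
  rw [Finset.mem_filter]
  refine ⟨natVec_mem hq b₀, fun p hp _ => ?_⟩
  exact incType_congr_mod a fun i => modEq_of_mem_primeFactors hp (natVec_modEq hq b₀ i)

/-- The cell `typeCell q w a b₀` is non-empty for `q ≥ 1`. -/
theorem typeCell_card_pos' {q : ℕ} (hq : 0 < q) (w : ℕ) (a b₀ : Fin t → ℤ) :
    0 < (typeCell q w a b₀).card :=
  Finset.card_pos.2 ⟨_, natVec_mem_typeCell' hq w a b₀⟩

/-! ### Frozen smooth moduli -/

/-- FROZEN SMOOTH MODULI: if every prime factor of the squarefree `q ≥ 1` is `≤ w`, a type-invariant spectrum takes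
the value `e q b₀` at every point of the cell, hence `condAvg q w a b₀ (e q) = e q b₀`. -/
theorem condAvg_eq_of_smooth {q w : ℕ} (hq : 1 ≤ q) (hsq : Squarefree q) (hsm : ∀ p ∈ q.primeFactors, p ≤ w)
    {a : Fin t → ℤ} {e : ℕ → (Fin t → ℤ) → ℝ} (he : TypeInvariant a e) (b₀ : Fin t → ℤ) :
    condAvg q w a b₀ (e q) = e q b₀ := by
  refine condAvg_eq_of_forall (typeCell_card_pos' hq w a b₀) fun v hv => ?_
  unfold typeCell at hv
  rw [Finset.mem_filter] at hv
  exact he q hsq _ b₀ fun p hp => hv.2 p hp (hsm p hp)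

/-- The sum of the absolute averages over the `w`-SMOOTH squarefree moduli `q ≤ Q` of a type-invariant spectrum is
`Σ |e q b₀|`. -/
theorem sum_smooth_condAvg_abs {Q w : ℕ} {a : Fin t → ℤ} {e : ℕ → (Fin t → ℤ) → ℝ} (he : TypeInvariant a e)
    (b₀ : Fin t → ℤ) :
    ∑ q ∈ ((Finset.Icc 1 Q).filter Squarefree).filter (fun q => ∀ p ∈ q.primeFactors, p ≤ w),
        condAvg q w a b₀ (fun b => |e q b|) =
      ∑ q ∈ ((Finset.Icc 1 Q).filter Squarefree).filter (fun q => ∀ p ∈ q.primeFactors, p ≤ w), |e q b₀| := by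
  refine Finset.sum_congr rfl fun q hq => ?_
  rw [Finset.mem_filter, Finset.mem_filter, Finset.mem_Icc] at hq
  have habs : TypeInvariant a (fun q b => |e q b|) := fun q' hq' b b' h => by
    show |e q' b| = |e q' b'|
    rw [he q' hq' b b' h]
  exact condAvg_eq_of_smooth hq.1.1.1 hq.1.2 hq.2 habs b₀

/-! ### The CRT factorisation of the cell -/

/-- CRT FACTORISATION OF A TYPE CELL. Let `q ≥ 1` be squarefree, `P = ∏_{p ≤ w} p`, `q₁ = gcd(q, P)`, `q₂ = q/q₁`.
If `F` is determined by the incidence types at the primes of `q₁` (relative to the target `b₀`) and `G` is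
`q₂`-periodic, then `condAvg q w a b₀ (F·G) = F(b₀) · (Σ_{y ∈ [0,q₂)^t} G y) / q₂^t`. -/
theorem condAvg_factor (w : ℕ) {q : ℕ} (hq : 1 ≤ q) (hsq : Squarefree q) (a b₀ : Fin t → ℤ)
    (F G : (Fin t → ℤ) → ℝ)
    (hF : ∀ b : Fin t → ℤ, (∀ p ∈ (Nat.gcd q (primorial w)).primeFactors, incType p a b = incType p a b₀) →
      F b = F b₀)
    (hG : ∀ b b' : Fin t → ℤ, (∀ i, b i ≡ b' i [ZMOD (q / Nat.gcd q (primorial w) : ℕ)]) → G b = G b') :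
    condAvg q w a b₀ (fun b => F b * G b) =
      F b₀ * ((∑ y ∈ Fintype.piFinset (fun _ : Fin t => Finset.range (q / Nat.gcd q (primorial w))),
        G (fun i => (y i : ℤ))) / (((q / Nat.gcd q (primorial w) : ℕ) : ℝ) ^ t)) := by
  -- the moduli
  set P := primorial w with hP
  set q₁ := Nat.gcd q P with hq₁
  have hq₁q : q₁ ∣ q := Nat.gcd_dvd_left q P
  have hq₁P : q₁ ∣ P := Nat.gcd_dvd_right q P
  have hq₁0 : 0 < q₁ := Nat.gcd_pos_of_pos_left P hq
  set q₂ := q / q₁ with hq₂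
  have hqq : q = q₁ * q₂ := by rw [hq₂, mul_comm, Nat.div_mul_cancel hq₁q]
  have hq0 : 0 < q := hq
  have hq₂0 : 0 < q₂ := Nat.div_pos (Nat.le_of_dvd hq hq₁q) hq₁0
  have hcop12 : Nat.Coprime q₁ q₂ := Nat.coprime_of_squarefree_mul (hqq ▸ hsq)
  -- the cell modulo `q` is cut out by the conditions at the primes of `q₁`
  have hcellq : typeCell q w a b₀ = (Fintype.piFinset fun _ : Fin t => range q).filter
      (fun v => ∀ p ∈ q₁.primeFactors, incType p a (fun i => (v i : ℤ)) = incType p a b₀) := by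
    unfold typeCell
    refine Finset.filter_congr fun v _ => ⟨fun H p hp => ?_, fun H p hp hpw => ?_⟩
    · have hp' := Nat.mem_primeFactors.1 hp
      exact H p (Nat.mem_primeFactors.2 ⟨hp'.1, hp'.2.1.trans hq₁q, hq0.ne'⟩)
        ((Nat.Prime.dvd_primorial_iff hp'.1).1 (hp'.2.1.trans hq₁P))
    · have hp' := Nat.mem_primeFactors.1 hp
      exact H p (Nat.mem_primeFactors.2
        ⟨hp'.1, Nat.dvd_gcd hp'.2.1 ((Nat.Prime.dvd_primorial_iff hp'.1).2 hpw), hq₁0.ne'⟩)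
  have hmodq : ∀ (r : Fin t → ℕ) (n : ℕ), ∀ i, ((r i : ℕ) : ℤ) ≡ ((Gallagher.modVec n r i : ℕ) : ℤ) [ZMOD n] :=
    fun r n i => by
      rw [Gallagher.modVec_apply, Int.natCast_mod]
      exact (Int.mod_modEq _ _).symm
  -- indicator of the `q₁`-conditions and the two factor sums
  set I₁ : (Fin t → ℕ) → ℝ := fun x =>
    if (∀ p ∈ q₁.primeFactors, incType p a (fun i => (x i : ℤ)) = incType p a b₀) then 1 else 0 with hI₁
  set G' : (Fin t → ℕ) → ℝ := fun y => G (fun i => (y i : ℤ)) with hG'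
  set K₁ : ℝ := ∑ x ∈ Fintype.piFinset (fun _ : Fin t => range q₁), I₁ x with hK₁
  -- denominator: `#typeCell q w a b₀ = K₁ q₂^t`
  have hKq : ((typeCell q w a b₀).card : ℝ) = K₁ * (q₂ : ℝ) ^ t := by
    rw [hcellq, Finset.card_eq_sum_ones, Nat.cast_sum, Finset.sum_filter, hqq]
    have e0 : (q₂ : ℝ) ^ t = ∑ _y ∈ Fintype.piFinset (fun _ : Fin t => range q₂), (1 : ℝ) := by
      rw [Finset.sum_const, Fintype.card_piFinset, Finset.prod_const, Finset.card_range, Finset.card_univ,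
        Fintype.card_fin, nsmul_eq_mul, mul_one]
      push_cast
      rfl
    rw [e0, ← sum_piFinset_mul_of_coprime hq₁0 hq₂0 hcop12 I₁ (fun _ => (1 : ℝ))]
    push_cast
    refine Finset.sum_congr rfl fun x _ => ?_
    have e1 := isCell_congr (P := q₁) a b₀ (fun i => (hmodq x q₁ i))
    rw [mul_one]
    simp only [hI₁]
    by_cases h1 : ∀ p ∈ q₁.primeFactors, incType p a (fun i => ((x i : ℕ) : ℤ)) = incType p a b₀
    · rw [if_pos h1, if_pos (e1.1 h1)]
    · rw [if_neg h1, if_neg (fun H => h1 (e1.2 H))]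
  have hK₁pos : 0 < K₁ := by
    have h0 : K₁ = ((typeCell q₁ q₁ a b₀).card : ℝ) := by
      rw [typeCell_self_eq_filter, Finset.card_eq_sum_ones, Nat.cast_sum, Finset.sum_filter]
      push_cast
      rfl
    rw [h0]
    exact_mod_cast typeCell_self_card_pos hq₁0 a b₀
  -- numerator: `Σ_{cell} F G = F(b₀) K₁ Σ_y G y`
  have hnum : ∑ v ∈ typeCell q w a b₀, F (fun i => (v i : ℤ)) * G (fun i => (v i : ℤ)) =
      F b₀ * (K₁ * ∑ y ∈ Fintype.piFinset (fun _ : Fin t => range q₂), G' y) := by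
    rw [hcellq, Finset.sum_filter, hqq, ← sum_piFinset_mul_of_coprime hq₁0 hq₂0 hcop12 I₁ G', Finset.mul_sum,
      ← hqq]
    refine Finset.sum_congr rfl fun r _ => ?_
    have e1 := isCell_congr (P := q₁) a b₀ (fun i => (hmodq r q₁ i))
    have eG : G (fun i => ((r i : ℕ) : ℤ)) = G' (Gallagher.modVec q₂ r) := by
      simp only [hG']
      exact hG _ _ fun i => hmodq r q₂ i
    simp only [hI₁]
    by_cases h1 : ∀ p ∈ q₁.primeFactors, incType p a (fun i => ((r i : ℕ) : ℤ)) = incType p a b₀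
    · rw [if_pos h1, if_pos (e1.1 h1), hF _ h1, eG]
      ring
    · rw [if_neg h1, if_neg (fun H => h1 (e1.2 H))]
      ring
  -- assembly
  unfold condAvg
  rw [hnum, hKq]
  have hq₂t : (0 : ℝ) < (q₂ : ℝ) ^ t := by positivity
  field_simp

/-- Registered hook (aux for `stub_typeRigidity`): the CRT factorisation of a type cell. -/
theorem rigidity_condAvg_factor : ∀ {t : ℕ} (w : ℕ) {q : ℕ}, 1 ≤ q → Squarefree q → ∀ (a b₀ : Fin t → ℤ) (F G : (Fin t → ℤ) → ℝ), (∀ b : Fin t → ℤ, (∀ p ∈ (Nat.gcd q (primorial w)).primeFactors, incType p a b = incType p a b₀) → F b = F b₀) → (∀ b b' : Fin t → ℤ, (∀ i, b i ≡ b' i [ZMOD (q / Nat.gcd q (primorial w) : ℕ)]) → G b = G b') → condAvg q w a b₀ (fun b => F b * G b) = F b₀ * ((∑ y ∈ Fintype.piFinset (fun _ : Fin t => Finset.range (q / Nat.gcd q (primorial w))), G (fun i => (y i : ℤ))) / (((q / Nat.gcd q (primorial w) : ℕ) : ℝ) ^ t)) :=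
  fun w _ hq hsq a b₀ F G hF hG => condAvg_factor w hq hsq a b₀ F G hF hG

end RigidityProof

end Summit.Parity.GeneralizedHardyLittlewood.Cruxes.RelativeDimOne.TypeSplit

end
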